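import Mathlib
import HarnessLib

/-!
# Kloosterman's degeneration of a quintic `G(2,5)`-section to the sum of two `k`-planes in a cubic

R. Kloosterman, *On a conjecture on Hodge loci of linear combinations of linear subvarieties*,
Rend. Circ. Mat. Palermo (2) 74 (2025), arXiv:2312.12363, §6, Proposition 6.4 and its proof
[cite: Kloosterman2025, Prop. 6.4]; companion of `QuarticTwoPlanesDegeneration.lean` (Prop. 6.1).

**The printed statement (Prop. 6.4).** "Let `k ≥ 2` be an integer. Let `X ⊂ ℙ^{2k+1}` be a cubic
hypersurface containing two `k`-planes `Π₁, Π₂` intersecting in dimension `k − 3`, then there exists a flat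
family of degree `d` hypersurfaces `(X_t, Y_t)` where `X_t` is a cubic hypersurface and `Y_t` is a linear
section of an iterated cone over the Plücker embedding of `G(2,5)`, for `t ≠ 0`, `X_0 = X` and
`[Y_0] = [Π₁] + [Π₂] + h^2` [the proof ends with `h^k`]." Cor. 6.5: for `d = 3`, `c = 3`, `k ≥ 2`,
`NL([Π₁],[Π₂])` is a subscheme of `NL([Π₁]+[Π₂])` of positive codimension; Rem. 6.6: "This two results
contain also a proof for [MovBook] for `d = 3`, however, where we take `ř = 1` rather than `−1`."

**The proof's computation.** With `Π₁ : x₀ = x₁ = x₂ = x_{k+4} = ⋯ = 0`, `Π₂ : x₃ = x₄ = x₅ = x_{k+4} = ⋯ = 0`,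
`F = Σ_{i=0}^{2} Σ_{j=3}^{5} xᵢxⱼL_{ij} + H` (`H = Σ_{j ≥ k+4} xⱼQⱼ`),
`f_t := Σ xᵢxⱼL_{ij} − t·det(L_{(i−1),(j+2)})_{i,j=1..3} + H`, and the five Plücker quadrics
`p₁ = p₁₂p₃₄ − p₁₃p₂₄ + p₁₄p₂₃`, `p₂ = p₁₂p₃₅ − p₁₃p₂₅ + p₁₅p₂₃`, `p₃ = p₁₂p₄₅ − p₁₄p₂₅ + p₁₅p₂₄`,
`p₄ = p₁₃p₄₅ − p₁₄p₃₅ + p₁₅p₃₄`, `p₅ = p₂₃p₄₅ − p₂₄p₃₅ + p₂₅p₃₄` cutting out `G(2,5) ⊂ ℙ⁹`, the source states: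
"if for `t ≠ 0` we substitute `(p₁₂,p₁₃,p₁₄,p₁₅,p₂₃,p₂₄,p₂₅,p₃₄,p₃₅,p₄₅) ↦ (x₀,x₁,L₂₄,L₂₅,x₂,−L₁₄,−L₂₅,L₀₄,L₀₅,x₃/t)`
in `x₄p₁ + x₅p₂ + t(L₀₃p₃ + L₁₃p₄ + L₂₃p₅)` then we obtain `f_t − H`."

This file PROVES that identity in an arbitrary commutative ring — with the substitution
`p₂₅ ↦ −L₁₅` (theorem `substituted_combination_eq`): the printed `p₂₅ ↦ −L₂₅` (which would use `L₂₅`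
twice and `L₁₅` never) is a misprint, as the kernel-checked identity shows; likewise the printed third
generator "`x₁x₃ − t(L₀₄L₁₅ + L₁₄L₀₅)`" of `I^{(t)}` is `t·p₄ = x₁x₃ + t(L₀₄L₂₅ − L₀₅L₂₄)` after the
substitution (`t_mul_plucker₄_subst`), while `t·p₃ = x₀x₃ + t(L₂₄L₁₅ − L₁₄L₂₅)` and
`t·p₅ = x₂x₃ + t(L₁₄L₀₅ − L₀₄L₁₅)` agree with the print. Consequences proved: `f_t − H` lies in the ideal
of the substituted Plücker quadrics (`deformedCubic_mem_pluckerIdeal`: `X_t ⊃ Y_t`), and the limit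
generators `p₁, p₂, x₀x₃, x₁x₃, x₂x₃` lie in `⟨x₀,x₁,x₂⟩` (the component `Π₁`) and in `⟨p₁,p₂,x₃⟩`
(`limitIdeal_le_planeComponent`, `limitIdeal_le_residualComponent`). NOT formalised: flatness (equality of
Hilbert functions), the identification of `V(I^{(t)})` with a cone section of `G(2,5)`, the class
computation `[Y_0] = [Π₁] + [Π₂] + h^k`, Cor. 6.5.

Last section: the Fermat cubic instance. Over a ring containing `ζ` with `ζ² = ζ − 1` (a primitive 6th root
of unity), `x³ + y³ = (x − ζy)(x − ζ³y)(x − ζ⁵y)`; hence for the planes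
`P = V(x₀−ζx₁, x₂−ζx₃, x₄−ζx₅, x₆−ζx₇)`, `P̌ = V(x₀−ζx₁, x₂−ζ³x₃, x₄−ζ³x₅, x₆−ζ³x₇)` of the Fermat cubic
sixfold (meeting in a point: `k = 3`, `c = 3`) Kloosterman's matrix `L` is DIAGONAL with entries
`ℓ_{2e} = x_{2e} − ζ⁵x_{2e+1}` and the deformation direction is `det L = ℓ₂ℓ₄ℓ₆`
(`fermatCubicSixfold_normalForm`) [folklore factorisation; the instance used by the Hodge-locus census
for Movasati's GADEPs problem, arXiv:2211.11405, case `(n,d,m) = (6,3,0)`].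
-/

namespace Literature.AlgebraicGeometry.Kloosterman2025

section Identities

variable {R : Type*} [CommRing R]

/-- The bilinear part `Σ_{i∈{0,1,2}, j∈{3,4,5}} xᵢxⱼL_{ij}` of Kloosterman's normal form of a cubic
containing `Π₁ = V(x₀,x₁,x₂,…)` and `Π₂ = V(x₃,x₄,x₅,…)`. [cite: Kloosterman2025, Prop. 6.4 (proof)] -/
def cubicNormalForm (x₀ x₁ x₂ x₃ x₄ x₅ L₀₃ L₀₄ L₀₅ L₁₃ L₁₄ L₁₅ L₂₃ L₂₄ L₂₅ : R) : R :=
  x₀ * x₃ * L₀₃ + x₀ * x₄ * L₀₄ + x₀ * x₅ * L₀₅ + x₁ * x₃ * L₁₃ + x₁ * x₄ * L₁₄ + x₁ * x₅ * L₁₅ +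
    x₂ * x₃ * L₂₃ + x₂ * x₄ * L₂₄ + x₂ * x₅ * L₂₅

/-- The deformation direction `det(L_{(i−1),(j+2)})_{i,j=1,2,3}` = the `3 × 3` determinant of the linear
forms `L_{ij}` (cofactor expansion along the first row). [cite: Kloosterman2025, Prop. 6.4 (proof)] -/
def detL (L₀₃ L₀₄ L₀₅ L₁₃ L₁₄ L₁₅ L₂₃ L₂₄ L₂₅ : R) : R :=
  L₀₃ * (L₁₄ * L₂₅ - L₁₅ * L₂₄) - L₀₄ * (L₁₃ * L₂₅ - L₁₅ * L₂₃) + L₀₅ * (L₁₃ * L₂₄ - L₁₄ * L₂₃)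

/-- `detL` is Mathlib's determinant of the matrix `(L_{ij})`. [cite: Kloosterman2025, Prop. 6.4 (proof)] -/
theorem detL_eq_det (L₀₃ L₀₄ L₀₅ L₁₃ L₁₄ L₁₅ L₂₃ L₂₄ L₂₅ : R) :
    detL L₀₃ L₀₄ L₀₅ L₁₃ L₁₄ L₁₅ L₂₃ L₂₄ L₂₅ = !![L₀₃, L₀₄, L₀₅; L₁₃, L₁₄, L₁₅; L₂₃, L₂₄, L₂₅].det := by
  rw [Matrix.det_fin_three]
  simp [detL]
  ring

/-- The five Plücker quadrics of `G(2,5) ⊂ ℙ⁹` as printed: `p₁ = p₁₂p₃₄ − p₁₃p₂₄ + p₁₄p₂₃`.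
[cite: Kloosterman2025, §6 (display before Prop. 6.4)] -/
def plucker₁ (p₁₂ p₁₃ p₁₄ p₂₃ p₂₄ p₃₄ : R) : R := p₁₂ * p₃₄ - p₁₃ * p₂₄ + p₁₄ * p₂₃
/-- `p₂ = p₁₂p₃₅ − p₁₃p₂₅ + p₁₅p₂₃`. [cite: Kloosterman2025, §6 (display before Prop. 6.4)] -/
def plucker₂ (p₁₂ p₁₃ p₁₅ p₂₃ p₂₅ p₃₅ : R) : R := p₁₂ * p₃₅ - p₁₃ * p₂₅ + p₁₅ * p₂₃
/-- `p₃ = p₁₂p₄₅ − p₁₄p₂₅ + p₁₅p₂₄`. [cite: Kloosterman2025, §6 (display before Prop. 6.4)] -/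
def plucker₃ (p₁₂ p₁₄ p₁₅ p₂₄ p₂₅ p₄₅ : R) : R := p₁₂ * p₄₅ - p₁₄ * p₂₅ + p₁₅ * p₂₄
/-- `p₄ = p₁₃p₄₅ − p₁₄p₃₅ + p₁₅p₃₄`. [cite: Kloosterman2025, §6 (display before Prop. 6.4)] -/
def plucker₄ (p₁₃ p₁₄ p₁₅ p₃₄ p₃₅ p₄₅ : R) : R := p₁₃ * p₄₅ - p₁₄ * p₃₅ + p₁₅ * p₃₄
/-- `p₅ = p₂₃p₄₅ − p₂₄p₃₅ + p₂₅p₃₄`. [cite: Kloosterman2025, §6 (display before Prop. 6.4)] -/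
def plucker₅ (p₂₃ p₂₄ p₂₅ p₃₄ p₃₅ p₄₅ : R) : R := p₂₃ * p₄₅ - p₂₄ * p₃₅ + p₂₅ * p₃₄

/-- **The substitution identity of the proof of Prop. 6.4**, for `t` invertible (`u·t = 1`, `p₄₅ ↦ u·x₃`):
substituting `(p₁₂,p₁₃,p₁₄,p₁₅,p₂₃,p₂₄,p₂₅,p₃₄,p₃₅,p₄₅) ↦ (x₀,x₁,L₂₄,L₂₅,x₂,−L₁₄,−L₁₅,L₀₄,L₀₅,x₃/t)`
(NB `p₂₅ ↦ −L₁₅`; the printed `−L₂₅` is a misprint) into `x₄p₁ + x₅p₂ + t(L₀₃p₃ + L₁₃p₄ + L₂₃p₅)` yields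
`f_t − H = Σ xᵢxⱼL_{ij} − t·det L`. [cite: Kloosterman2025, Prop. 6.4 (proof)] -/
theorem substituted_combination_eq (x₀ x₁ x₂ x₃ x₄ x₅ L₀₃ L₀₄ L₀₅ L₁₃ L₁₄ L₁₅ L₂₃ L₂₄ L₂₅ t u : R)
    (hu : u * t = 1) :
    x₄ * plucker₁ x₀ x₁ L₂₄ x₂ (-L₁₄) L₀₄ + x₅ * plucker₂ x₀ x₁ L₂₅ x₂ (-L₁₅) L₀₅ +
        t * (L₀₃ * plucker₃ x₀ L₂₄ L₂₅ (-L₁₄) (-L₁₅) (u * x₃) +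
          L₁₃ * plucker₄ x₁ L₂₄ L₂₅ L₀₄ L₀₅ (u * x₃) + L₂₃ * plucker₅ x₂ (-L₁₄) (-L₁₅) L₀₄ L₀₅ (u * x₃)) =
      cubicNormalForm x₀ x₁ x₂ x₃ x₄ x₅ L₀₃ L₀₄ L₀₅ L₁₃ L₁₄ L₁₅ L₂₃ L₂₄ L₂₅ -
        t * detL L₀₃ L₀₄ L₀₅ L₁₃ L₁₄ L₁₅ L₂₃ L₂₄ L₂₅ := by
  unfold plucker₁ plucker₂ plucker₃ plucker₄ plucker₅ cubicNormalForm detL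
  linear_combination (L₀₃ * x₀ * x₃ + L₁₃ * x₁ * x₃ + L₂₃ * x₂ * x₃) * hu

/-- `t·p₃` after the substitution: `x₀x₃ + t(L₂₄L₁₅ − L₁₄L₂₅)` (as printed).
[cite: Kloosterman2025, Prop. 6.4 (proof)] -/
theorem t_mul_plucker₃_subst (x₀ x₃ L₁₄ L₁₅ L₂₄ L₂₅ t u : R) (hu : u * t = 1) :
    t * plucker₃ x₀ L₂₄ L₂₅ (-L₁₄) (-L₁₅) (u * x₃) = x₀ * x₃ + t * (L₂₄ * L₁₅ - L₁₄ * L₂₅) := by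
  unfold plucker₃
  linear_combination (x₀ * x₃) * hu

/-- `t·p₄` after the substitution: `x₁x₃ + t(L₀₄L₂₅ − L₀₅L₂₄)` (the printed "`x₁x₃ − t(L₀₄L₁₅ + L₁₄L₀₅)`" is a
misprint). [cite: Kloosterman2025, Prop. 6.4 (proof)] -/
theorem t_mul_plucker₄_subst (x₁ x₃ L₀₄ L₀₅ L₂₄ L₂₅ t u : R) (hu : u * t = 1) :
    t * plucker₄ x₁ L₂₄ L₂₅ L₀₄ L₀₅ (u * x₃) = x₁ * x₃ + t * (L₀₄ * L₂₅ - L₀₅ * L₂₄) := by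
  unfold plucker₄
  linear_combination (x₁ * x₃) * hu

/-- `t·p₅` after the substitution: `x₂x₃ + t(L₁₄L₀₅ − L₀₄L₁₅)` (as printed).
[cite: Kloosterman2025, Prop. 6.4 (proof)] -/
theorem t_mul_plucker₅_subst (x₂ x₃ L₀₄ L₀₅ L₁₄ L₁₅ t u : R) (hu : u * t = 1) :
    t * plucker₅ x₂ (-L₁₄) (-L₁₅) L₀₄ L₀₅ (u * x₃) = x₂ * x₃ + t * (L₁₄ * L₀₅ - L₀₄ * L₁₅) := by
  unfold plucker₅
  linear_combination (x₂ * x₃) * hu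

/-- The ideal `I^{(t)} = ⟨p₁, p₂, p₃, p₄, p₅⟩` of the substituted Plücker quadrics (without the linear
generators `x_{k+4}, …`; for `t` invertible `⟨p₃,p₄,p₅⟩ = ⟨tp₃,tp₄,tp₅⟩`).
[cite: Kloosterman2025, Prop. 6.4 (proof)] -/
def pluckerIdeal (x₀ x₁ x₂ x₃ L₀₄ L₀₅ L₁₄ L₁₅ L₂₄ L₂₅ u : R) : Ideal R :=
  Ideal.span {plucker₁ x₀ x₁ L₂₄ x₂ (-L₁₄) L₀₄, plucker₂ x₀ x₁ L₂₅ x₂ (-L₁₅) L₀₅,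
    plucker₃ x₀ L₂₄ L₂₅ (-L₁₄) (-L₁₅) (u * x₃), plucker₄ x₁ L₂₄ L₂₅ L₀₄ L₀₅ (u * x₃),
    plucker₅ x₂ (-L₁₄) (-L₁₅) L₀₄ L₀₅ (u * x₃)}

/-- **`X_t ⊃ Y_t`**: for `t` invertible, `f_t − H = Σ xᵢxⱼL_{ij} − t·det L` lies in the ideal of the
substituted Plücker quadrics (coefficients `x₄, x₅, tL₀₃, tL₁₃, tL₂₃`); adding `H ∈ J = ⟨x_{k+4},…⟩` keeps
`f_t` in `I^{(t)} + J`. [cite: Kloosterman2025, Prop. 6.4 (proof)] -/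
theorem deformedCubic_mem_pluckerIdeal (x₀ x₁ x₂ x₃ x₄ x₅ L₀₃ L₀₄ L₀₅ L₁₃ L₁₄ L₁₅ L₂₃ L₂₄ L₂₅ t u h : R)
    (J : Ideal R) (hu : u * t = 1) (hh : h ∈ J) :
    cubicNormalForm x₀ x₁ x₂ x₃ x₄ x₅ L₀₃ L₀₄ L₀₅ L₁₃ L₁₄ L₁₅ L₂₃ L₂₄ L₂₅ -
          t * detL L₀₃ L₀₄ L₀₅ L₁₃ L₁₄ L₁₅ L₂₃ L₂₄ L₂₅ + h ∈
      pluckerIdeal x₀ x₁ x₂ x₃ L₀₄ L₀₅ L₁₄ L₁₅ L₂₄ L₂₅ u ⊔ J := by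
  refine Submodule.add_mem_sup ?_ hh
  rw [← substituted_combination_eq x₀ x₁ x₂ x₃ x₄ x₅ L₀₃ L₀₄ L₀₅ L₁₃ L₁₄ L₁₅ L₂₃ L₂₄ L₂₅ t u hu]
  unfold pluckerIdeal
  have m : ∀ y ∈ ({plucker₁ x₀ x₁ L₂₄ x₂ (-L₁₄) L₀₄, plucker₂ x₀ x₁ L₂₅ x₂ (-L₁₅) L₀₅,
      plucker₃ x₀ L₂₄ L₂₅ (-L₁₄) (-L₁₅) (u * x₃), plucker₄ x₁ L₂₄ L₂₅ L₀₄ L₀₅ (u * x₃),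
      plucker₅ x₂ (-L₁₄) (-L₁₅) L₀₄ L₀₅ (u * x₃)} : Set R),
      y ∈ Ideal.span ({plucker₁ x₀ x₁ L₂₄ x₂ (-L₁₄) L₀₄, plucker₂ x₀ x₁ L₂₅ x₂ (-L₁₅) L₀₅,
        plucker₃ x₀ L₂₄ L₂₅ (-L₁₄) (-L₁₅) (u * x₃), plucker₄ x₁ L₂₄ L₂₅ L₀₄ L₀₅ (u * x₃),
        plucker₅ x₂ (-L₁₄) (-L₁₅) L₀₄ L₀₅ (u * x₃)} : Set R) := fun y hy ↦ Ideal.subset_span hy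
  refine Ideal.add_mem _ (Ideal.add_mem _ (Ideal.mul_mem_left _ _ (m _ (by simp)))
    (Ideal.mul_mem_left _ _ (m _ (by simp)))) (Ideal.mul_mem_left _ _ ?_)
  exact Ideal.add_mem _ (Ideal.add_mem _ (Ideal.mul_mem_left _ _ (m _ (by simp)))
    (Ideal.mul_mem_left _ _ (m _ (by simp)))) (Ideal.mul_mem_left _ _ (m _ (by simp)))

/-- The substituted `p₁ = x₀L₀₄ + x₁L₁₄ + x₂L₂₄` and `p₂ = x₀L₀₅ + x₁L₁₅ + x₂L₂₅` (the regrouping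
`x₄(x₀L₀₄ + x₁L₁₄ + x₂L₂₄) + x₅(x₀L₀₅ + x₁L₁₅ + x₂L₂₅) + ⋯` of the proof).
[cite: Kloosterman2025, Prop. 6.4 (proof)] -/
theorem plucker₁₂_subst (x₀ x₁ x₂ L₀₄ L₀₅ L₁₄ L₁₅ L₂₄ L₂₅ : R) :
    plucker₁ x₀ x₁ L₂₄ x₂ (-L₁₄) L₀₄ = x₀ * L₀₄ + x₁ * L₁₄ + x₂ * L₂₄ ∧
      plucker₂ x₀ x₁ L₂₅ x₂ (-L₁₅) L₀₅ = x₀ * L₀₅ + x₁ * L₁₅ + x₂ * L₂₅ := by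
  unfold plucker₁ plucker₂
  constructor <;> ring

/-- The limit ideal `I^{(0)} = ⟨p₁, p₂, x₀x₃, x₁x₃, x₂x₃⟩` is contained in `⟨x₀, x₁, x₂⟩` (the component
`Π₁`). [cite: Kloosterman2025, Prop. 6.4 (proof)] -/
theorem cubicLimitIdeal_le_planeComponent (x₀ x₁ x₂ x₃ L₀₄ L₀₅ L₁₄ L₁₅ L₂₄ L₂₅ : R) :
    Ideal.span {plucker₁ x₀ x₁ L₂₄ x₂ (-L₁₄) L₀₄, plucker₂ x₀ x₁ L₂₅ x₂ (-L₁₅) L₀₅,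
        x₀ * x₃, x₁ * x₃, x₂ * x₃} ≤ Ideal.span {x₀, x₁, x₂} := by
  have h0 : x₀ ∈ Ideal.span ({x₀, x₁, x₂} : Set R) := Ideal.subset_span (by simp)
  have h1 : x₁ ∈ Ideal.span ({x₀, x₁, x₂} : Set R) := Ideal.subset_span (by simp)
  have h2 : x₂ ∈ Ideal.span ({x₀, x₁, x₂} : Set R) := Ideal.subset_span (by simp)
  apply Ideal.span_le.2
  intro y hy
  simp only [Set.mem_insert_iff, Set.mem_singleton_iff] at hy
  rcases hy with rfl | rfl | rfl | rfl | rfl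
  · rw [(plucker₁₂_subst x₀ x₁ x₂ L₀₄ L₀₅ L₁₄ L₁₅ L₂₄ L₂₅).1]
    exact Ideal.add_mem _ (Ideal.add_mem _ (Ideal.mul_mem_right _ _ h0) (Ideal.mul_mem_right _ _ h1))
      (Ideal.mul_mem_right _ _ h2)
  · rw [(plucker₁₂_subst x₀ x₁ x₂ L₀₄ L₀₅ L₁₄ L₁₅ L₂₄ L₂₅).2]
    exact Ideal.add_mem _ (Ideal.add_mem _ (Ideal.mul_mem_right _ _ h0) (Ideal.mul_mem_right _ _ h1))
      (Ideal.mul_mem_right _ _ h2)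
  · exact Ideal.mul_mem_right _ _ h0
  · exact Ideal.mul_mem_right _ _ h1
  · exact Ideal.mul_mem_right _ _ h2

/-- … and in `⟨p₁, p₂, x₃⟩` (the residual component `V(p₁, p₂, x₃)`).
[cite: Kloosterman2025, Prop. 6.4 (proof)] -/
theorem cubicLimitIdeal_le_residualComponent (x₀ x₁ x₂ x₃ L₀₄ L₀₅ L₁₄ L₁₅ L₂₄ L₂₅ : R) :
    Ideal.span {plucker₁ x₀ x₁ L₂₄ x₂ (-L₁₄) L₀₄, plucker₂ x₀ x₁ L₂₅ x₂ (-L₁₅) L₀₅,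
        x₀ * x₃, x₁ * x₃, x₂ * x₃} ≤
      Ideal.span {plucker₁ x₀ x₁ L₂₄ x₂ (-L₁₄) L₀₄, plucker₂ x₀ x₁ L₂₅ x₂ (-L₁₅) L₀₅, x₃} := by
  have h3 : x₃ ∈ Ideal.span ({plucker₁ x₀ x₁ L₂₄ x₂ (-L₁₄) L₀₄, plucker₂ x₀ x₁ L₂₅ x₂ (-L₁₅) L₀₅, x₃} :
      Set R) := Ideal.subset_span (by simp)
  apply Ideal.span_le.2
  intro y hy
  simp only [Set.mem_insert_iff, Set.mem_singleton_iff] at hy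
  rcases hy with rfl | rfl | rfl | rfl | rfl
  · exact Ideal.subset_span (by simp)
  · exact Ideal.subset_span (by simp)
  · exact Ideal.mul_mem_left _ _ h3
  · exact Ideal.mul_mem_left _ _ h3
  · exact Ideal.mul_mem_left _ _ h3

end Identities

section FermatInstance

variable {R : Type*} [CommRing R]

/-- Factorisation of the binary Fermat cubic over a ring containing `ζ` with `ζ² = ζ − 1` (a primitive 6th
root of unity, e.g. `ζ₆ = e^{2πi/6} ∈ ℂ`; then `ζ³ = −1`, `ζ⁵ = 1 − ζ`):
`x³ + y³ = (x − ζy)(x − ζ³y)(x − ζ⁵y)`. [folklore] -/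
theorem fermatCubic_factor (ζ x y : R) (hζ : ζ ^ 2 = ζ - 1) :
    x ^ 3 + y ^ 3 = (x - ζ * y) * (x - ζ ^ 3 * y) * (x - ζ ^ 5 * y) := by
  have h3 : ζ ^ 3 = -1 := by linear_combination (ζ + 1) * hζ
  have h5 : ζ ^ 5 = 1 - ζ := by linear_combination (ζ ^ 3 + ζ ^ 2 - 1) * hζ
  rw [h3, h5]
  linear_combination (x + y) * y ^ 2 * hζ

/-- The Fermat cubic sixfold `x₀³ + ⋯ + x₇³` is in Kloosterman's normal form with respect to the planes
`P = V(x₀−ζx₁, x₂−ζx₃, x₄−ζx₅, x₆−ζx₇)` and `P̌ = V(x₀−ζx₁, x₂−ζ³x₃, x₄−ζ³x₅, x₆−ζ³x₇)` (meeting in a point;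
shared form `y₀ = x₀ − ζx₁` in the role of `x_{k+4} = x₇`, `k = 3`): with Kloosterman's
`(x₀,x₁,x₂ | x₃,x₄,x₅) = (x₂−ζx₃, x₄−ζx₅, x₆−ζx₇ | x₂−ζ³x₃, x₄−ζ³x₅, x₆−ζ³x₇)` the matrix `L` is diagonal,
`L₀₃ = x₂ − ζ⁵x₃`, `L₁₄ = x₄ − ζ⁵x₅`, `L₂₅ = x₆ − ζ⁵x₇`, the other `L_{ij} = 0`, and
`H = (x₀ − ζx₁)·(x₀ − ζ³x₁)(x₀ − ζ⁵x₁)`; so the deformation direction is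
`det L = (x₂ − ζ⁵x₃)(x₄ − ζ⁵x₅)(x₆ − ζ⁵x₇)`. [folklore] (instance of [cite: Kloosterman2025, Prop. 6.4 (proof)]) -/
theorem fermatCubicSixfold_normalForm (ζ x₀ x₁ x₂ x₃ x₄ x₅ x₆ x₇ : R) (hζ : ζ ^ 2 = ζ - 1) :
    x₀ ^ 3 + x₁ ^ 3 + x₂ ^ 3 + x₃ ^ 3 + x₄ ^ 3 + x₅ ^ 3 + x₆ ^ 3 + x₇ ^ 3 =
      cubicNormalForm (x₂ - ζ * x₃) (x₄ - ζ * x₅) (x₆ - ζ * x₇) (x₂ - ζ ^ 3 * x₃) (x₄ - ζ ^ 3 * x₅)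
          (x₆ - ζ ^ 3 * x₇) (x₂ - ζ ^ 5 * x₃) 0 0 0 (x₄ - ζ ^ 5 * x₅) 0 0 0 (x₆ - ζ ^ 5 * x₇) +
        (x₀ - ζ * x₁) * ((x₀ - ζ ^ 3 * x₁) * (x₀ - ζ ^ 5 * x₁)) ∧
      detL (x₂ - ζ ^ 5 * x₃) 0 0 0 (x₄ - ζ ^ 5 * x₅) 0 0 0 (x₆ - ζ ^ 5 * x₇) =
        (x₂ - ζ ^ 5 * x₃) * (x₄ - ζ ^ 5 * x₅) * (x₆ - ζ ^ 5 * x₇) := by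
  refine ⟨?_, by unfold detL; ring⟩
  have e₀ := fermatCubic_factor ζ x₀ x₁ hζ
  have e₂ := fermatCubic_factor ζ x₂ x₃ hζ
  have e₄ := fermatCubic_factor ζ x₄ x₅ hζ
  have e₆ := fermatCubic_factor ζ x₆ x₇ hζ
  unfold cubicNormalForm
  linear_combination e₀ + e₂ + e₄ + e₆

end FermatInstance

end Literature.AlgebraicGeometry.Kloosterman2025
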